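import Literature.AlgebraicGeometry.Resolution.ArithmeticalThreefoldsLocalFibre
import Literature.AlgebraicGeometry.Resolution.ArithmeticalThreefoldsLocal
import Literature.AlgebraicGeometry.Resolution.PowerSeriesRegularLocal
import Literature.AlgebraicGeometry.Resolution.LocalBlowup
import Mathlib.RingTheory.RegularLocalRing.Polynomial
import Mathlib.RingTheory.Valuation.LocalSubring
import HarnessLib

/-!
# Cossart–Piltant 2019, the local theorem: reduction to a singular rational centre with `h ≡ X^p`

Topic: `Literature/AlgebraicGeometry/Resolution` (proofs only: no new notions, no named facts).
Third file of helper results towards `CossartPiltant2019Local_holds` (journal Thm. 1.5 = arXiv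
v1 Thm. 1.4), after `ArithmeticalThreefoldsLocalProofs.lean` (Ch. 2, p. 9; Prop. 2.3) and
`ArithmeticalThreefoldsLocalFibre.lean` (§2.3, Prop. 2.10). It PROVES the first reduction of the
local theorem that the paper performs at the start of Ch. 2 (arXiv v1 pp. 9–16): one may assume
that the centre `x` of `μ` on `𝒳 = Spec S[X]/(h)` is a SINGULAR point — otherwise there is
nothing to do — and then, by Prop. 2.10 ("`η⁻¹(s) = {x}`, `k(x) = k(s)`", proof: "`h̄(Z)` is …
a `p`-th power … `h̄(Z) = (Z - λ̄)^p` … we have `λ̄ = 0`" after the translation `Z := X - λ`),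
that `x` is the rational closed point `(m_S, X)` with `h ≡ X^p mod m_S`:

* `CossartPiltant2019Local.of_normalForm` — **`CossartPiltant2019Local` follows from its
  restriction to data with `h ≡ X^p mod m_S[X]` and `f_{p,X} ∈ m_S²`** (i.e. all
  `f_{i,X} ∈ m_S` and the rational point `x = (m_S, X)`, the only point of `𝒳` over `m_S`, is
  singular: `ord_x h ≥ 2`).

The proof assembles: `x ∈ 𝒪_μ` (valuation rings are integrally closed); if `S[x]` is regular at
the centre we are done with `t = ∅`; otherwise the centre `Q` is a singular point of
`𝒳 = Spec S[x] = Spec S[X]/(h)` (`Polynomial.Monic.exists_mul_mem_sq_of_not_isRegularLocalRing`: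
`S[X]_𝔑` is regular as `S` is — Mathlib's
`Polynomial.isRegularLocalRing_localization_atPrime_of_comap_eq_maximalIdeal` — so
non-regularity of `S[X]_𝔑/(h)` means `h ∈ 𝔑² S[X]_𝔑`, Matsumura 14.2, via
`isRegularLocalRing_localization_quotient_of_forall` of `PowerSeriesRegularLocal.lean`), hence by
Prop. 2.10 (`Polynomial.Monic.exists_map_eq_X_sub_C_pow_of_hypothesisG`) `h ≡ (X - a)^p mod m_S`
with `𝔑 = (m_S, X - a)`; the translated data `x' := x - a`, `h' := h(X + a)` satisfy every
hypothesis of the local theorem again (same `S[x'] = S[x]`, `K(x') = L`, `h'` monic irreducible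
of degree `p`, (i) resp. (ii) preserved) together with the normal form, and the conclusion for
`(h', x')` is the conclusion for `(h, x)` since `S[x'][t] = S[x][t]`.

## Sources

* V. Cossart, O. Piltant, *Resolution of singularities of arithmetical threefolds*, J. Algebra
  529 (2019) 268–535 = arXiv:1412.0868: Thm. 1.4 (v1 p. 4), Ch. 2 (v1 p. 9), Prop. 2.3 (v1 p. 11),
  §2.3 and Prop. 2.10 (v1 pp. 15–16), Def. 2.5 / well adapted coordinates (v1 p. 12, "`λ̄ = 0`").
  [CossartPiltant2019]
* H. Matsumura, *Commutative Ring Theory*, Thm. 14.2. [Matsumura1987]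
-/

noncomputable section

open Polynomial Finset IsLocalRing

namespace Literature.AlgebraicGeometry.Resolution

universe u

section Transport

variable {S : Type u} [CommRing S] {K : Type u} [Field K] [Algebra S K] [IsFractionRing S K]
  {L : Type u} [Field L] [Algebra K L] [Algebra S L] [IsScalarTower S K L]

/-- `S[X]/(h) ≃ₐ[S] S[x]` **with its formula** `g mod (h) ↦ g(x)`, in the setting of
`CossartPiltant2019Local` (cf. `Polynomial.Monic.nonempty_quotient_span_algEquiv_adjoin`).
[cite: CossartPiltant2019, Ch. 2 (arXiv v1 p. 9, (2.2))] -/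
theorem Polynomial.Monic.exists_quotient_span_algEquiv_adjoin_apply_mk {h : S[X]} (hh : h.Monic)
    (hirr : Irreducible (h.map (algebraMap S K))) {x : L} (hx : aeval x h = 0) :
    ∃ e : (S[X] ⧸ Ideal.span {h}) ≃ₐ[S] Algebra.adjoin S ({x} : Set L),
      ∀ g : S[X], (e (Ideal.Quotient.mk (Ideal.span {h}) g) : L) = aeval x g := by
  let f : S[X] →ₐ[S] (aeval x : S[X] →ₐ[S] L).range := (aeval x).rangeRestrict
  have hf : Function.Surjective f := (aeval x).rangeRestrict_surjective
  have hker : RingHom.ker (f : S[X] →+* (aeval x : S[X] →ₐ[S] L).range) = Ideal.span {h} := by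
    rw [← Polynomial.Monic.ker_aeval_eq_span_of_irreducible_map (K := K) hh hirr hx]
    ext g
    simp only [RingHom.mem_ker]
    constructor
    · intro hg
      exact congrArg Subtype.val hg
    · intro hg
      exact Subtype.ext hg
  let e₁ : (S[X] ⧸ RingHom.ker (f : S[X] →+* (aeval x : S[X] →ₐ[S] L).range)) ≃ₐ[S]
      (aeval x : S[X] →ₐ[S] L).range := Ideal.quotientKerAlgEquivOfSurjective hf
  let e₀ : (S[X] ⧸ Ideal.span {h}) ≃ₐ[S]
      (S[X] ⧸ RingHom.ker (f : S[X] →+* (aeval x : S[X] →ₐ[S] L).range)) :=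
    Ideal.quotientEquivAlgOfEq S hker.symm
  let e₂ : (aeval x : S[X] →ₐ[S] L).range ≃ₐ[S] Algebra.adjoin S ({x} : Set L) :=
    Subalgebra.equivOfEq _ _ (Algebra.adjoin_singleton_eq_range_aeval S x).symm
  refine ⟨(e₀.trans e₁).trans e₂, fun g => ?_⟩
  rw [AlgEquiv.trans_apply, AlgEquiv.trans_apply]
  change ((e₁ (e₀ (Ideal.Quotient.mk (Ideal.span {h}) g)) : (aeval x : S[X] →ₐ[S] L).range) : L)
    = aeval x g
  have h0 : e₀ (Ideal.Quotient.mk (Ideal.span {h}) g) = Ideal.Quotient.mk _ g :=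
    Ideal.quotientEquivAlgOfEq_mk S hker.symm g
  rw [h0]
  change ((Ideal.quotientKerAlgEquivOfSurjective hf (Ideal.Quotient.mk _ g) :
    (aeval x : S[X] →ₐ[S] L).range) : L) = aeval x g
  rw [Ideal.quotientKerAlgEquivOfSurjective_mk]
  rfl

omit [IsFractionRing S K] in
/-- Localizations at corresponding primes along a ring isomorphism are isomorphic (the `comap`
form; the `map` form is `Localization.nonempty_atPrime_ringEquiv_of_ringEquiv` of
`NodalCurveSmoothLocus.lean`). [folklore] -/
theorem Localization.nonempty_atPrime_comap_ringEquiv {A A' : Type*} [CommRing A]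
    [CommRing A'] (e : A ≃+* A') (Q : Ideal A') [Q.IsPrime] :
    haveI : (Q.comap (e : A →+* A')).IsPrime := Ideal.comap_isPrime _ Q
    Nonempty (Localization.AtPrime (Q.comap (e : A →+* A')) ≃+* Localization.AtPrime Q) := by
  haveI : (Q.comap (e : A →+* A')).IsPrime := Ideal.comap_isPrime _ Q
  refine ⟨IsLocalization.ringEquivOfRingEquiv (M := (Q.comap (e : A →+* A')).primeCompl)
    (T := Q.primeCompl) (Localization.AtPrime (Q.comap (e : A →+* A'))) (Localization.AtPrime Q)
    e ?_⟩
  ext y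
  constructor
  · rintro ⟨z, hz, rfl⟩
    exact hz
  · intro hy
    refine ⟨e.symm y, ?_, e.apply_symm_apply y⟩
    change e.symm y ∉ Q.comap (e : A →+* A')
    rw [Ideal.mem_comap]
    change ¬ e (e.symm y) ∈ Q
    rw [e.apply_symm_apply]
    exact hy

/-- **A non-regular point of `𝒳 = Spec S[x]` is a singular point of the hypersurface
`Spec S[X]/(h)`**: for `S` a regular local ring and a prime `Q` of `S[x]` over `m_S`
(setting of `CossartPiltant2019Local`), if `S[x]_Q` is not a regular local ring then
`ord_𝔑 h ≥ 2` at the corresponding point `𝔑` of `Spec S[X]` (`s h ∈ 𝔑²` for some `s ∉ 𝔑`).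
Indeed `S[X]_𝔑` is regular and `S[x]_Q ≅ S[X]_𝔑/(h)` is regular as soon as `h ∉ 𝔑² S[X]_𝔑`
(Matsumura, Thm. 14.2). In the paper this is the (implicit) identification of the non-regular
locus of `𝒳` with `Sing 𝒳 = {y : m(y) ≥ 2}` (v1 p. 9). [cite: CossartPiltant2019, Ch. 2 (arXiv v1 p. 9)] -/
theorem Polynomial.Monic.exists_mul_mem_sq_of_not_isRegularLocalRing [IsRegularLocalRing S]
    {h : S[X]} (hh : h.Monic) (hirr : Irreducible (h.map (algebraMap S K))) {x : L}
    (hx : aeval x h = 0) (Q : Ideal (Algebra.adjoin S ({x} : Set L))) [hQ : Q.IsPrime]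
    (h𝔞Q : maximalIdeal S ≤ Q.comap (algebraMap S (Algebra.adjoin S ({x} : Set L))))
    (hreg : ¬ IsRegularLocalRing (Localization.AtPrime Q)) :
    ∃ s ∉ Q.comap (aeval (⟨x, Algebra.self_mem_adjoin_singleton S x⟩ :
        Algebra.adjoin S ({x} : Set L))).toRingHom,
      s * h ∈ Q.comap (aeval (⟨x, Algebra.self_mem_adjoin_singleton S x⟩ :
        Algebra.adjoin S ({x} : Set L))).toRingHom ^ 2 := by
  obtain ⟨e, he⟩ :=
    Polynomial.Monic.exists_quotient_span_algEquiv_adjoin_apply_mk (K := K) hh hirr hx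
  let P : Ideal (S[X] ⧸ Ideal.span {h}) := Q.comap (e : (S[X] ⧸ Ideal.span {h}) →+* _)
  haveI hP : P.IsPrime := Ideal.comap_isPrime _ Q
  -- the point `𝔑` of `Spec S[X]`, in both descriptions
  have h𝔑 : P.comap (Ideal.Quotient.mk (Ideal.span {h})) =
      Q.comap (aeval (⟨x, Algebra.self_mem_adjoin_singleton S x⟩ :
        Algebra.adjoin S ({x} : Set L))).toRingHom := by
    ext g
    rw [Ideal.mem_comap, Ideal.mem_comap, Ideal.mem_comap]
    have : (e : (S[X] ⧸ Ideal.span {h}) →+* _) (Ideal.Quotient.mk (Ideal.span {h}) g) =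
        aeval (⟨x, Algebra.self_mem_adjoin_singleton S x⟩ : Algebra.adjoin S ({x} : Set L)) g := by
      apply Subtype.ext
      rw [aeval_subalgebra_coe]
      exact he g
    rw [this]
    rfl
  haveI : (P.comap (Ideal.Quotient.mk (Ideal.span {h}))).IsPrime := Ideal.comap_isPrime _ P
  -- `S[X]_𝔑` is regular: `𝔑 ∩ S = m_S`
  have hmax : (P.comap (Ideal.Quotient.mk (Ideal.span {h}))).comap C = maximalIdeal S := by
    have hle : maximalIdeal S ≤ (P.comap (Ideal.Quotient.mk (Ideal.span {h}))).comap C := by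
      rw [h𝔑, ← Ideal.map_le_iff_le_comap]
      exact Ideal.map_C_le_comap_aeval_of_le_comap Q h𝔞Q
    have hne : (P.comap (Ideal.Quotient.mk (Ideal.span {h}))).comap C ≠ ⊤ :=
      (Ideal.comap_isPrime C _).ne_top
    exact ((IsLocalRing.maximalIdeal.isMaximal S).eq_of_le hne hle).symm
  haveI := Polynomial.isRegularLocalRing_localization_atPrime_of_comap_eq_maximalIdeal S
    (P.comap (Ideal.Quotient.mk (Ideal.span {h}))) hmax
  by_contra hcon
  push Not at hcon
  have hregP : IsRegularLocalRing (Localization.AtPrime P) := by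
    refine isRegularLocalRing_localization_quotient_of_forall h P fun w hw hwf => ?_
    rw [h𝔑] at hw hwf
    exact hcon w hw hwf
  obtain ⟨ε⟩ := Localization.nonempty_atPrime_comap_ringEquiv
    (e : (S[X] ⧸ Ideal.span {h}) ≃ₐ[S] _).toRingEquiv Q
  exact hreg (@IsRegularLocalRing.of_ringEquiv _ _ hregP _ _ ε)


/-! ## Translating the `X`-coordinate: `x' := x - a`, `h' := h(X + a)` -/

omit [IsFractionRing S K] in
/-- `S[x - a, t] = S[x, t]` for `a ∈ S`. [folklore] -/
theorem Algebra.adjoin_insert_sub_algebraMap (a : S) (x : L) (t : Set L) :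
    Algebra.adjoin S (insert (x - algebraMap S L a) t) = Algebra.adjoin S (insert x t) := by
  apply le_antisymm
  · rw [Algebra.adjoin_le_iff, Set.insert_subset_iff]
    refine ⟨Subalgebra.sub_mem _ (Algebra.subset_adjoin (Set.mem_insert x t))
      (Subalgebra.algebraMap_mem _ a), ?_⟩
    exact (Set.subset_insert x t).trans Algebra.subset_adjoin
  · rw [Algebra.adjoin_le_iff, Set.insert_subset_iff]
    refine ⟨?_, (Set.subset_insert _ t).trans Algebra.subset_adjoin⟩
    have h1 : x - algebraMap S L a ∈ Algebra.adjoin S (insert (x - algebraMap S L a) t) :=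
      Algebra.subset_adjoin (Set.mem_insert _ t)
    have h2 : algebraMap S L a ∈ Algebra.adjoin S (insert (x - algebraMap S L a) t) :=
      Subalgebra.algebraMap_mem _ a
    simpa using Subalgebra.add_mem _ h1 h2

omit [IsFractionRing S K] in
/-- `S[x - a] = S[x]` for `a ∈ S`. [folklore] -/
theorem Algebra.adjoin_singleton_sub_algebraMap (a : S) (x : L) :
    Algebra.adjoin S ({x - algebraMap S L a} : Set L) = Algebra.adjoin S ({x} : Set L) := by
  rw [Set.singleton_def, Set.singleton_def x, Algebra.adjoin_insert_sub_algebraMap]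

omit [IsFractionRing S K] in
/-- `K(x - a) = K(x)` (`= L`) for `a ∈ S`. [folklore] -/
theorem Algebra.adjoin_singleton_sub_algebraMap_eq_top (a : S) {x : L}
    (hKx : Algebra.adjoin K ({x} : Set L) = ⊤) :
    Algebra.adjoin K ({x - algebraMap S L a} : Set L) = ⊤ := by
  rw [eq_top_iff, ← hKx, Algebra.adjoin_le_iff, Set.singleton_subset_iff, SetLike.mem_coe]
  have h1 : x - algebraMap S L a ∈ Algebra.adjoin K ({x - algebraMap S L a} : Set L) :=
    Algebra.subset_adjoin (Set.mem_singleton _)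
  have h2 : algebraMap S L a ∈ Algebra.adjoin K ({x - algebraMap S L a} : Set L) := by
    rw [IsScalarTower.algebraMap_apply S K L]
    exact Subalgebra.algebraMap_mem _ _
  simpa using Subalgebra.add_mem _ h1 h2

omit [IsFractionRing S K] in
/-- `h(X + a)` is monic of the same degree as the monic `h`. [folklore] -/
theorem Polynomial.Monic.comp_X_add_C' {h : S[X]} (hh : h.Monic) (a : S) :
    (h.comp (X + C a)).Monic ∧ (h.comp (X + C a)).natDegree = h.natDegree := by
  refine ⟨hh.comp_X_add_C a, ?_⟩
  rw [← taylor_apply, natDegree_taylor]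

omit [IsFractionRing S K] in
/-- `x - a` is a root of `h(X + a)`. [folklore] -/
theorem Polynomial.aeval_sub_algebraMap_comp_X_add_C (h : S[X]) (a : S) (x : L) :
    aeval (x - algebraMap S L a) (h.comp (X + C a)) = aeval x h := by
  rw [aeval_comp]
  simp

omit [IsFractionRing S K] in
/-- `h(X + a)` is irreducible over `K` when `h` is (`g ↦ g(X + a)` is an automorphism of
`K[X]`). [folklore] -/
theorem Polynomial.irreducible_map_comp_X_add_C {h : S[X]}
    (hirr : Irreducible (h.map (algebraMap S K))) (a : S) :
    Irreducible ((h.comp (X + C a)).map (algebraMap S K)) := by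
  have : (h.comp (X + C a)).map (algebraMap S K) =
      taylorEquiv (algebraMap S K a) (h.map (algebraMap S K)) := by
    rw [Polynomial.map_comp, Polynomial.map_add, map_X, map_C]
    rfl
  rw [this]
  exact (MulEquiv.irreducible_iff (taylorEquiv (algebraMap S K a)).toMulEquiv).mpr hirr

/-- Hypothesis (i) of `CossartPiltant2019Local` is stable under `X ↦ X + a`: in characteristic
`p`, `(X + a)^p + f_p = X^p + (a^p + f_p)`. [cite: CossartPiltant2019, §2.3 (G)(c) (arXiv v1 p. 15)] -/
theorem Polynomial.Monic.coeff_comp_X_add_C_eq_zero {p : ℕ} (hp : p.Prime) [CharP K p] {h : S[X]}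
    (hh : h.Monic) (hdeg : h.natDegree = p) (hcoeff : ∀ i, 0 < i → i < p → h.coeff i = 0)
    (a : S) : ∀ i, 0 < i → i < p → (h.comp (X + C a)).coeff i = 0 := by
  haveI : CharP S p := (algebraMap S K).charP (IsFractionRing.injective S K) p
  haveI : Fact p.Prime := ⟨hp⟩
  -- `h = X^p + C (h.coeff 0)`
  have hshape : h = X ^ p + C (h.coeff 0) := by
    ext i
    rw [coeff_add, coeff_X_pow, coeff_C]
    rcases Nat.lt_trichotomy i p with hi | rfl | hi
    · rcases Nat.eq_zero_or_pos i with rfl | hi0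
      · rw [if_neg (Ne.symm hp.ne_zero), if_pos rfl, zero_add]
      · rw [hcoeff i hi0 hi, if_neg hi.ne, if_neg hi0.ne', add_zero]
    · have : h.coeff h.natDegree = 1 := hh
      rw [hdeg] at this
      rw [this, if_pos rfl, if_neg hp.ne_zero, add_zero]
    · have : h.coeff i = 0 := coeff_eq_zero_of_natDegree_lt (by omega)
      rw [this, if_neg hi.ne', if_neg (by omega), add_zero]
  intro i hi0 hip
  rw [hshape, add_comp, X_pow_comp, C_comp, add_pow_char, ← C_pow, coeff_add, coeff_add,
    coeff_X_pow, coeff_C, coeff_C, if_neg hip.ne, if_neg hi0.ne', if_neg hi0.ne']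
  ring

end Transport

/-! ## The reduction -/

section Reduction

/-- **First reduction of the local theorem** (Cossart–Piltant 2019, start of Ch. 2 with
Prop. 2.10, arXiv v1 pp. 9–16): `CossartPiltant2019Local` follows from its restriction to data
`(S, h, x, μ)` in NORMAL FORM

* `h ≡ X^p mod m_S[X]`, i.e. `f_{1,X}, …, f_{p,X} ∈ m_S` — the centre of `μ` on
  `𝒳 = Spec S[x]` is then the rational closed point `x = (m_S, X)`, the only point of
  `Spec S[X] ⊇ 𝒳` over `m_S` containing `h` — and
* `f_{p,X} ∈ m_S²`, i.e. (`Polynomial.mem_sup_span_X_sub_C_pow_iff`) `h ∈ (m_S, X)²`: the centre is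
  a SINGULAR point of `𝒳` (`ord_x h ≥ 2`).

Proof: `x ∈ 𝒪_μ`; if `S[x]` is regular at the centre, take `t = ∅`; otherwise the centre is
singular (`Polynomial.Monic.exists_mul_mem_sq_of_not_isRegularLocalRing`), so by Prop. 2.10
(`Polynomial.Monic.exists_map_eq_X_sub_C_pow_of_hypothesisG`) `h ≡ (X - a)^p mod m_S` and the
centre is `(m_S, X - a)`; translate `x' := x - a`, `h' := h(X + a)` — all hypotheses persist
(`Algebra.adjoin_insert_sub_algebraMap`, `Algebra.adjoin_singleton_sub_algebraMap_eq_top`,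
`Polynomial.irreducible_map_comp_X_add_C`, `Polynomial.Monic.coeff_comp_X_add_C_eq_zero`), the
normal form holds for `h'`, and the conclusion for `(h', x')` is the one for `(h, x)`.
[cite: CossartPiltant2019, Prop. 2.10 (arXiv v1 pp. 15–16) and Ch. 2 (v1 p. 9)] -/
theorem CossartPiltant2019Local.of_normalForm
    (H : ∀ (p : ℕ), p.Prime →
      ∀ (S : Type u) [CommRing S] [IsDomain S] [IsRegularLocalRing S],
        IsExcellentRing S → ringKrullDim S = 3 → CharP (ResidueField S) p →
      ∀ (K : Type u) [Field K] [Algebra S K] [IsFractionRing S K]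
        (L : Type u) [Field L] [Algebra K L] [Algebra S L] [IsScalarTower S K L]
        (h : S[X]) (x : L),
        h.Monic → h.natDegree = p → Irreducible (h.map (algebraMap S K)) → aeval x h = 0 →
        Algebra.adjoin K ({x} : Set L) = ⊤ →
        ((CharP K p ∧ ∀ i, 0 < i → i < p → h.coeff i = 0) ∨
          (Nat.card (L ≃ₐ[K] L) = p ∧
            ∀ σ : L ≃ₐ[K] L, ∀ y ∈ Algebra.adjoin S ({x} : Set L),
              σ y ∈ Algebra.adjoin S ({x} : Set L))) →
        -- the normal form:
        h.map (Ideal.Quotient.mk (maximalIdeal S)) = X ^ p →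
        h.coeff 0 ∈ maximalIdeal S ^ 2 →
      ∀ (O : ValuationSubring L), (∀ s : S, algebraMap S L s ∈ O) →
        (∀ s ∈ maximalIdeal S, O.valuation (algebraMap S L s) < 1) →
        ∃ (t : Finset L) (ht : (Algebra.adjoin S (insert x (t : Set L))).toSubring ≤ O.toSubring),
          IsRegularLocalRing (Localization.AtPrime
            (Ideal.comap (Subring.inclusion ht) (maximalIdeal O)))) :
    CossartPiltant2019Local.{u} := by
  intro p hp S _ _ _ hexc hdim hchar K _ _ _ L _ _ _ _ h x hh hdeg hirr hx hKx hG O hO hOm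
  classical
  haveI : Fact p.Prime := ⟨hp⟩
  haveI : CharP (ResidueField S) p := hchar
  -- `x ∈ O`: valuation rings are integrally closed
  have hxO : x ∈ O := by
    letI : Algebra S O := ((algebraMap S L).codRestrict O.toSubring fun s => hO s).toAlgebra
    haveI : IsScalarTower S O L := IsScalarTower.of_algebraMap_eq fun _ => rfl
    have hint : IsIntegral S x := ⟨h, hh, by rwa [← aeval_def]⟩
    obtain ⟨y, hy⟩ := IsIntegrallyClosed.algebraMap_eq_of_integral (IsIntegral.tower_top (A := O) hint)
    rw [← hy]
    exact y.2
  -- every `S[y, t]` with `y ∈ O`, `t ⊆ O` lies in `O`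
  have hadjO : ∀ (u : Set L), u ⊆ O → (Algebra.adjoin S u).toSubring ≤ O.toSubring := by
    intro u hu
    rw [Algebra.adjoin_eq_ring_closure]
    refine Subring.closure_le.mpr (Set.union_subset ?_ hu)
    rintro _ ⟨s, rfl⟩
    exact hO s
  -- the model `B = S[x] ⊆ O` and its centre `Q`
  have hB : (Algebra.adjoin S ({x} : Set L)).toSubring ≤ O.toSubring :=
    hadjO {x} (Set.singleton_subset_iff.mpr hxO)
  let Q : Ideal (Algebra.adjoin S ({x} : Set L)) :=
    subringCentre (Algebra.adjoin S ({x} : Set L)).toSubring O hB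
  haveI hQ : Q.IsPrime := subringCentre.isPrime _ O hB
  have h𝔞Q : maximalIdeal S ≤ Q.comap (algebraMap S (Algebra.adjoin S ({x} : Set L))) := by
    intro s hs
    rw [Ideal.mem_comap]
    change algebraMap S (Algebra.adjoin S ({x} : Set L)) s ∈
      subringCentre (Algebra.adjoin S ({x} : Set L)).toSubring O hB
    rw [mem_subringCentre_iff]
    exact hOm s hs
  by_cases hreg : IsRegularLocalRing (Localization.AtPrime Q)
  · -- nothing to do: `t = ∅`
    have heq : (Algebra.adjoin S (insert x ((∅ : Finset L) : Set L))).toSubring =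
        (Algebra.adjoin S ({x} : Set L)).toSubring := by
      rw [Finset.coe_empty, ← Set.singleton_def]
    have hempty : (Algebra.adjoin S (insert x ((∅ : Finset L) : Set L))).toSubring ≤ O.toSubring :=
      heq ▸ hB
    exact ⟨∅, hempty, (isRegularLocalRing_centre_congr heq hempty hB).mpr hreg⟩
  -- the centre is a singular point: `s₀ h ∈ 𝔑²`, `s₀ ∉ 𝔑`
  obtain ⟨s₀, hs₀, hs₀h⟩ :=
    Polynomial.Monic.exists_mul_mem_sq_of_not_isRegularLocalRing (K := K) hh hirr hx Q h𝔞Q hreg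
  -- Prop. 2.10: `h ≡ (X - a)^p`, `𝔑 = (m_S, X - a)`
  obtain ⟨a, hha, h𝔑a⟩ :=
    Polynomial.Monic.exists_map_eq_X_sub_C_pow_of_hypothesisG hp hh hdeg hx hKx hG Q h𝔞Q hs₀ hs₀h
  -- translate: `x' := x - a`, `h' := h(X + a)`
  set x' : L := x - algebraMap S L a with hx'def
  set h' : S[X] := h.comp (X + C a) with hh'def
  have hh' : h'.Monic := (Polynomial.Monic.comp_X_add_C' hh a).1
  have hdeg' : h'.natDegree = p := (Polynomial.Monic.comp_X_add_C' hh a).2.trans hdeg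
  have hirr' : Irreducible (h'.map (algebraMap S K)) :=
    Polynomial.irreducible_map_comp_X_add_C hirr a
  have hx' : aeval x' h' = 0 := by
    rw [hx'def, hh'def, Polynomial.aeval_sub_algebraMap_comp_X_add_C, hx]
  have hKx' : Algebra.adjoin K ({x'} : Set L) = ⊤ :=
    Algebra.adjoin_singleton_sub_algebraMap_eq_top a hKx
  have hG' : (CharP K p ∧ ∀ i, 0 < i → i < p → h'.coeff i = 0) ∨
      (Nat.card (L ≃ₐ[K] L) = p ∧
        ∀ σ : L ≃ₐ[K] L, ∀ y ∈ Algebra.adjoin S ({x'} : Set L),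
          σ y ∈ Algebra.adjoin S ({x'} : Set L)) := by
    rcases hG with ⟨hcharK, hcoeff⟩ | ⟨hcard, hstab⟩
    · haveI := hcharK
      exact Or.inl ⟨hcharK, Polynomial.Monic.coeff_comp_X_add_C_eq_zero (K := K) hp hh hdeg hcoeff a⟩
    · refine Or.inr ⟨hcard, ?_⟩
      rw [hx'def, Algebra.adjoin_singleton_sub_algebraMap]
      exact hstab
  -- the normal form for `h'`
  have hnf : h'.map (Ideal.Quotient.mk (maximalIdeal S)) = X ^ p := by
    rw [hh'def, Polynomial.map_comp, hha, Polynomial.map_add, map_X, map_C, pow_comp, sub_comp,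
      X_comp, C_comp, add_sub_cancel_right]
  have hsing : h'.coeff 0 ∈ maximalIdeal S ^ 2 := by
    haveI : (Q.comap (aeval (R := S) (⟨x, Algebra.self_mem_adjoin_singleton S x⟩ :
        Algebra.adjoin S ({x} : Set L))).toRingHom).IsPrime := Ideal.comap_isPrime _ Q
    have hmax : (Q.comap (aeval (R := S) (⟨x, Algebra.self_mem_adjoin_singleton S x⟩ :
        Algebra.adjoin S ({x} : Set L))).toRingHom).IsMaximal := by
      rw [h𝔑a]
      exact Polynomial.isMaximal_sup_span_X_sub_C (IsLocalRing.maximalIdeal.isMaximal S) a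
    have hh2 := Ideal.IsMaximal.mem_pow_of_mul_mem_pow hmax hs₀ hs₀h
    rw [h𝔑a, Polynomial.mem_sup_span_X_sub_C_pow_iff] at hh2
    have := hh2 0
    rwa [Nat.sub_zero, taylor_apply] at this
  -- apply the normal-form statement to `(h', x')` and translate back
  obtain ⟨t, ht, hregt⟩ := H p hp S hexc hdim hchar K L h' x' hh' hdeg' hirr' hx' hKx' hG' hnf hsing
    O hO hOm
  have heq : (Algebra.adjoin S (insert x' (t : Set L))).toSubring =
      (Algebra.adjoin S (insert x (t : Set L))).toSubring := by
    rw [hx'def, Algebra.adjoin_insert_sub_algebraMap]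
  have ht2 : (Algebra.adjoin S (insert x (t : Set L))).toSubring ≤ O.toSubring := heq ▸ ht
  exact ⟨t, ht2, (isRegularLocalRing_centre_congr heq ht ht2).mp hregt⟩

/-- **The two remaining cases of the local theorem, as in Cor. 5.2** (Cossart–Piltant 2019,
arXiv v1 p. 58: "Theorem 1.4 is then an immediate consequence of [CoP4] Main Theorem 1.3
(`m(x) < p`), theorem 2.23 (`(m(x), ω(x)) = (p, 0)`) and theorem 5.1"): after
`CossartPiltant2019Local.of_normalForm` the centre is the singular rational point `x = (m_S, X)`
with `h ≡ X^p mod m_S`, and its multiplicity `m(x) = ord_x h ∈ {2, …, p}` is read off the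
coefficients (`Polynomial.algebraMap_mem_maximalIdeal_pow_natDegree_iff` with `a = 0`:
`m(x) = p ⟺ f_{i,X} ∈ m_Sⁱ` for `1 ≤ i ≤ p`). So `CossartPiltant2019Local` follows from the
normal-form statement in the two cases
(1) **`m(x) < p`**: some `f_{i,X} ∉ m_Sⁱ` — the case of [CoP4] (Cossart–Piltant, RACSAM 108
(2014), Main Thm. 1.3), and (2) **`m(x) = p`**: all `f_{i,X} ∈ m_Sⁱ` — the case of Ch. 2–9 of the
paper (Thm. 2.23 and the Projection Theorem 5.1). Purely logical on top of `of_normalForm`; it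
records the exact shape of the two open sub-goals.
[cite: CossartPiltant2019, Cor. 5.2 (arXiv v1 p. 58)] -/
theorem CossartPiltant2019Local.of_normalForm_cases
    (Hlt : ∀ (p : ℕ), p.Prime →
      ∀ (S : Type u) [CommRing S] [IsDomain S] [IsRegularLocalRing S],
        IsExcellentRing S → ringKrullDim S = 3 → CharP (ResidueField S) p →
      ∀ (K : Type u) [Field K] [Algebra S K] [IsFractionRing S K]
        (L : Type u) [Field L] [Algebra K L] [Algebra S L] [IsScalarTower S K L]
        (h : S[X]) (x : L),
        h.Monic → h.natDegree = p → Irreducible (h.map (algebraMap S K)) → aeval x h = 0 →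
        Algebra.adjoin K ({x} : Set L) = ⊤ →
        ((CharP K p ∧ ∀ i, 0 < i → i < p → h.coeff i = 0) ∨
          (Nat.card (L ≃ₐ[K] L) = p ∧
            ∀ σ : L ≃ₐ[K] L, ∀ y ∈ Algebra.adjoin S ({x} : Set L),
              σ y ∈ Algebra.adjoin S ({x} : Set L))) →
        h.map (Ideal.Quotient.mk (maximalIdeal S)) = X ^ p →
        h.coeff 0 ∈ maximalIdeal S ^ 2 →
        -- case `m(x) < p`:
        (∃ i, 1 ≤ i ∧ i ≤ p ∧ h.coeff (p - i) ∉ maximalIdeal S ^ i) →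
      ∀ (O : ValuationSubring L), (∀ s : S, algebraMap S L s ∈ O) →
        (∀ s ∈ maximalIdeal S, O.valuation (algebraMap S L s) < 1) →
        ∃ (t : Finset L) (ht : (Algebra.adjoin S (insert x (t : Set L))).toSubring ≤ O.toSubring),
          IsRegularLocalRing (Localization.AtPrime
            (Ideal.comap (Subring.inclusion ht) (maximalIdeal O))))
    (Heq : ∀ (p : ℕ), p.Prime →
      ∀ (S : Type u) [CommRing S] [IsDomain S] [IsRegularLocalRing S],
        IsExcellentRing S → ringKrullDim S = 3 → CharP (ResidueField S) p →
      ∀ (K : Type u) [Field K] [Algebra S K] [IsFractionRing S K]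
        (L : Type u) [Field L] [Algebra K L] [Algebra S L] [IsScalarTower S K L]
        (h : S[X]) (x : L),
        h.Monic → h.natDegree = p → Irreducible (h.map (algebraMap S K)) → aeval x h = 0 →
        Algebra.adjoin K ({x} : Set L) = ⊤ →
        ((CharP K p ∧ ∀ i, 0 < i → i < p → h.coeff i = 0) ∨
          (Nat.card (L ≃ₐ[K] L) = p ∧
            ∀ σ : L ≃ₐ[K] L, ∀ y ∈ Algebra.adjoin S ({x} : Set L),
              σ y ∈ Algebra.adjoin S ({x} : Set L))) →
        h.map (Ideal.Quotient.mk (maximalIdeal S)) = X ^ p →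
        -- case `m(x) = p` (it contains `f_{p,X} ∈ m_S^p ⊆ m_S²`):
        (∀ i, 1 ≤ i → i ≤ p → h.coeff (p - i) ∈ maximalIdeal S ^ i) →
      ∀ (O : ValuationSubring L), (∀ s : S, algebraMap S L s ∈ O) →
        (∀ s ∈ maximalIdeal S, O.valuation (algebraMap S L s) < 1) →
        ∃ (t : Finset L) (ht : (Algebra.adjoin S (insert x (t : Set L))).toSubring ≤ O.toSubring),
          IsRegularLocalRing (Localization.AtPrime
            (Ideal.comap (Subring.inclusion ht) (maximalIdeal O)))) :
    CossartPiltant2019Local.{u} := by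
  refine CossartPiltant2019Local.of_normalForm fun p hp S _ _ _ hexc hdim hchar K _ _ _ L _ _ _ _
    h x hh hdeg hirr hx hKx hG hnf h0 O hO hOm => ?_
  by_cases hm : ∀ i, 1 ≤ i → i ≤ p → h.coeff (p - i) ∈ maximalIdeal S ^ i
  · exact Heq p hp S hexc hdim hchar K L h x hh hdeg hirr hx hKx hG hnf hm O hO hOm
  · push Not at hm
    obtain ⟨i, hi1, hip, hi⟩ := hm
    exact Hlt p hp S hexc hdim hchar K L h x hh hdeg hirr hx hKx hG hnf h0 ⟨i, hi1, hip, hi⟩ O hO hOm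

/-- In the normal form, **`m(x) = p` iff `f_{i,X} ∈ m_Sⁱ` for all `i`**: the hypothesis of the
second case of `CossartPiltant2019Local.of_normalForm_cases` is literally "`ord_x h ≥ p`" at the
centre `x = (m_S, X)`, i.e. `h/1 ∈ (𝔑 S[X]_𝔑)^p` for `𝔑 = (m_S, X)` (and `ord_x h ≤ p` always,
`Polynomial.Monic.le_natDegree_of_algebraMap_mem_maximalIdeal_pow`). (Cossart–Piltant 2019, v1
p. 9: `Sing_p 𝒳 = {y : ord_y h = p}`.) [cite: CossartPiltant2019, Ch. 2 (arXiv v1 p. 9)] -/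
theorem Polynomial.forall_coeff_mem_pow_iff_algebraMap_mem_maximalIdeal_pow {S : Type u}
    [CommRing S] [IsLocalRing S] {p : ℕ} {h : S[X]} (hdeg : h.natDegree = p)
    (S' : Type*) [CommRing S'] [Algebra S[X] S']
    [hmax : ((maximalIdeal S).map (C : S →+* S[X]) ⊔ Ideal.span {X - C (0 : S)}).IsMaximal]
    [IsLocalization.AtPrime S' ((maximalIdeal S).map (C : S →+* S[X]) ⊔ Ideal.span {X - C (0 : S)})]
    [IsLocalRing S'] :
    (∀ i, 1 ≤ i → i ≤ p → h.coeff (p - i) ∈ maximalIdeal S ^ i) ↔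
      algebraMap S[X] S' h ∈ maximalIdeal S' ^ p := by
  rw [← hdeg, Polynomial.algebraMap_mem_maximalIdeal_pow_natDegree_iff (𝔞 := maximalIdeal S) (0 : S) S',
    taylor_zero]

end Reduction

end Literature.AlgebraicGeometry.Resolution

end
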